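import Literature.MathematicalPhysics.QuantumFieldTheory.Balaban1983to89.B8SockB9P3ShellModeVacuityUniv
import Literature.MathematicalPhysics.QuantumFieldTheory.Balaban1983to89.Node00.CarriersB8SubBH

/-!
# `Balaban1983to89.B8Prop3ShellModeVacuity` — KERNEL CERTIFICATE: [Balaban1985RegularSpaces] PROPOSITION 3 (p. 87) **AS TYPED ON THE
# RECORD's CARRIER** (`B8LeafModelZd3.zdGF3`: the (1.42) HYPOTHESIS `C137` read on the member's OWN bond class `i.Λb` = law №12's
# `towerBonds`, which has NO crossing bond) IS FALSE at the lawful `k = 1` shell member `(T, □₁)` of the sub-index of record `IdxB8SubB θ`;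
# hence the N05 slot `Node00.B8LeafOfRecordSubBH θ λ` (whose `p3` field is that sentence over ALL of `IdxB8SubB θ`) is UNINHABITED for
# every residual layer `λ` — the typed frame is STRONGER than print (print's (1.42) ranges over the 𝔅_k∕(1.31) class WITH the crossing
# contours, which kill the mode: dag-n05-c `B8Ineq159FlatShellModeCrossingDatum` p578369)

statement-level skeleton of published theorems with citation tags; proofs (a NEGATIVE certificate about a TYPED frame); nothing here is a
claim about the Yang–Mills mass gap, and NOTHING of [Balaban1985RegularSpaces] is refuted

T. Bałaban, *Spaces of regular gauge field configurations on a lattice and gauge fixing conditions*, Commun. Math. Phys. **99** (1985) 75–102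
`[Balaban1985RegularSpaces]` ("B8"): Prop. 3 p. 87 («If U₀, U₁U₀ satisfy (1.40)–(1.42) with α₀, α₁, α₂ bounded by a constant depending on d and L
only, and α₂ satisfies the additional restriction (1.61), then U₁ satisfies (1.36)–(1.39) with B₁ = 5dLB₀, …»), (1.40)–(1.42) p. 83, (1.36)–(1.39)
p. 82, (1.31) p. 82 (the constraint-bond class: inner bonds AND crossing contours), (1.55)–(1.62) pp. 86–87, (1.131) p. 99 (the cube tower,
«Λ′₀ = T ∖ □₁»).  T. Bałaban, *Averaging operations for lattice gauge theories*, Commun. Math. Phys. **98** (1985) 17–51 `[Balaban1985Averaging]`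
("B7"), Prop. 4 (133)–(135) pp. 38–39 (the second-order remainder of the averaging composite, here at `U₀ = 1`: `B7Prop4Flat.prop4_flat`).
PDF held: `paper:balaban1985-cmp99-regular-spaces-gauge-fixing` (journal page = PDF page + 74): p0013 (Prop. 3), p0009 ((1.40)–(1.42)),
p0008 ((1.31), (1.36)–(1.39)), p0012–13 ((1.55)–(1.62)).

CITATION HEADER (lean-in-tree rule).  Cell `pub-ymgap` (HUMAN RULING D-0062, Track A), DAG node N05 = [B8], seat `pub-ymgap-dag-n05-d` (g10; R134
row s2, the `Ω₀ = ℤᵈ` road; target of record `h05S` = the `.b8` slot `B8LeafOfRecordSubBH`).  WHY THIS FILE.  dag-n16-w2 g0 LOCATED (cell bus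
2026-08-27 23:02Z, Q1) that the interior-shell gauge mode of dag-n05-c's certificates (`B8Ineq159FlatShellModeVacuity` p572834,
`B8SockB9P3ShellModeVacuityUniv` p576185: the (1.59)-type SOCKETS over the typed class are unsatisfiable above truncation 0) ALSO refutes
PROPOSITION 3 AS TYPED on the record's carrier, because there the (1.42) clause `C137 α₁` is a HYPOTHESIS read on the member's own class
`i.Λb i.k j` (`B8LeafModelZd3.zdGF3` :189) — at a law member `towerBonds`, no crossing bond — so the typed Prop. 3 has a WEAKER hypothesis than
print's and asserts more; this seat (the slot's consumer of record) confirmed the reading at declaration level and types the certificate here.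
THE ARGUMENT (member `k = 1`, `η = L⁻¹`, `Ω₀ = ℤᵈ`, `Ω₁ = □₁`, `Λs 1 0 = ℤᵈ ∖ □₁`, `Λs 1 1 = □₁⁽¹⁾`, `Λb = towerBonds`; any nontrivial C⋆-algebra 𝔸;
`d, L ≥ 2`): take `U₀ = 1`, `A′ = t·∂λ₁·1_𝔸` with `λ₁` the REAL unit shell mode of `exists_real_shellMode` (supported in `□₁`, `≠ 0`, equal `L`-block
sums over `□₁⁽¹⁾`, Landau block-constancy) and `W = e^{iηA′}` (a pure gauge).  Fix the jump bond `b₀ = ⟨y₀, y₀ + e₀⟩` of `λ₁` (`λ₁(y₀) ≠ 0 =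
λ₁(y₀ + e₀)`, `m₀ := |λ₁(y₀)| > 0`) and `M₁ := 2Λ₀ + 1 ≥ sup|∂λ₁|·`; put `t := α₂∕(M₁L)`, `α₀ := α₂²`, `α₁ := K′α₂²`, `K′ := C₂(d) + 2|C₂| + 3`
(`C₂(d)` = [B7] Prop. 4's flat constant `B7Prop4Flat.C2`).  Then for every `0 < α₂ ≤ min{c, 1∕16, 1∕(20d), c∕K′, c₄(d), m₀∕(2Q)}`: (1.40) `1 ∈ 𝔄`,
`W·1 ∈ 𝔄` (pure gauge); `Reg335 := ⊤`; (1.41) `C162 1 α₂` (`‖A′‖ ≤ tM₁η⁻¹ = α₂(Lη)⁻¹`, `(iη)⁻¹log W = A′`); Landau of record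
(`isLandau138_univ_of_shellMode`); (1.42) `C137 α₁` ON `towerBonds`: level 0 — both ends off `□₁`, `A′ = 0`; level 1 — both blocks inside `□₁`, the
LINEAR part of the composite vanishes (`linCovIter_one_grad_level_one` + equal block sums) and [B7] Prop. 4 at `U₀ = 1` bounds the rest by
`C₂(d)·(L·tM₁)² = C₂(d)α₂² < 2dLα₁`; (1.61) holds by the schedule.  Prop. 3's conclusion (1.36)₁ at `b₀` (level 0) reads `η⁻¹·t·m₀ = ‖A′(b₀)‖ ≤
5dLB₀(α₀ + α₁)η⁻¹ = 5dLB₀(1 + K′)α₂²η⁻¹`, i.e. `m₀ ≤ Q·α₂` with `Q := 5dLB₀(1 + K′)M₁L` — false for `α₂ ≤ m₀∕(2Q)`.  In print the level-1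
CROSSING bonds `⟨c₋ ∈ Λ₀-block, c₊ ∈ □₁⁽¹⁾⟩` carry the datum `L^{−d}·i·Σ_{B(c₊)}λ ≠ 0` (p578369), (1.42) then forces `α₁ ≳ α₂` and there is no
contradiction: the refuted object is the TYPED (1.42) class, not Bałaban's Proposition 3.

WHAT THIS FILE PROVES (theorems only, no `def`; standard axioms).
§1 `norm_logCovIter_one_one_le` — [B7] Prop. 4 at `U₀ = 1`, one step: `‖Q₁(1, B)(c)‖ ≤ ‖Q₁(1)B(c)‖ + C₂(d)(L·b)²` for `‖B‖ ≤ b`, `Lb ≤ c₄(d)`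
   (`B7Prop4Flat.prop4_flat` + `mlog_dbavgIter` + `logCovIter_one_left` + `B9Eq316TowerFlatIsOneStep.linCovIter_one_left`, by name).
§2 ★★ `not_prop3Body_zdGF3_topCube` — at every `ZdIdx` member whose data are print's `(T, □₁)` with `k = 1` and `Λb 1 = towerBonds`, for EVERY
   threshold `c > 0`, (1.61)-constant `C₂`, inputs `inp` (`B₀ = inp.B₀ > 0`), `B₀β`, Hölder data `β, len`: `¬ B8.Prop3Body c d L C₂ inp B₀β (fun _ :
   Unit => (zdGF3 𝔸 L β len i).toGFData2)`; ★★ `not_prop3Printed_zdGF3_topCube`.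
§3 ★★★ `not_prop3Printed_famB8OfRecordSubBH` (`θ.D ≥ 2`; every `C₂ inp B₀β β len`): Prop. 3 as typed on the record's sub-family is FALSE;
   ★★★ `not_b8LeafOfRecordSubBH : ∀ lam, ¬ B8LeafOfRecordSubBH θ lam` — THE N05 SLOT OF RECORD IS UNINHABITED AS TYPED (A6 on the RECORD's
   carrier: the repair is a carrier edition — `C137` over print's class `B8TowerBondsPrinted.towerBondsP L i.Ω (i.Λs i.k) j` — not a supplier edition);
   the same on g31's law-free sub-index: ★★★ `not_prop3Printed_famB8OfRecord`, ★★★ `not_b8LeafOfRecord : ∀ lam, ¬ Node00.B8LeafOfRecord θ lam`.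
   CONSEQUENCE (by contraposition, not restated as theorems): every landed `…_of_…` theorem CONCLUDING one of these slots (this seat's g5–g9 knits
   `BalabanUVNodesN05SubBHKnitUniv*`, `…T8Srv`, `…OfThm33(Lin∕P6Beta)`; n05-a's `B8LeafKnitZd3*` over `IdxB8`-type families containing a shell member)
   has a jointly UNSATISFIABLE hypothesis set at `D ≥ 2`, and every record predicate with such a slot as a conjunct is empty as typed.

HONEST SCOPE.  A kernel refutation of a TYPED frame by an explicit field; the refuted statements' hypotheses are jointly satisfiable at the
witness (the member exists: `exists_topCube_member_lawsB`; `inp`, `c` free) — not an empty-index or ex-falso refutation.  NOTHING of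
[Balaban1985RegularSpaces] is refuted or proved; the typed (1.42) class (law №12 ∕ `ZdIdx.hbox`) is narrower than print's (1.31) class, which
is the located cause (dag-n05-c LOCATED-1, 2026-08-27).  Count-neutral; N05 NOT discharged (its slot as typed is shown EMPTY; the re-typed slot is
the planners' ∕ node00-def's edition); `T_η ↦ ℤᵈ`; one finite `T⁴` programme at fixed `ε` — nothing continuum ∕ ℝ⁴ ∕ OS ∕ mass-gap ∕ Clay.  No
`sorry`, no `def`, no `instance`, no `notation`.  Unit `pub-ymgap-dag-n05-d` (g10), 2026-08-27; located by dag-n16-w2 g0 (Q1), whose scalar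
second-order lemma is here supplied BY NAME from [B7] Prop. 4 flat (`B7Prop4Flat.prop4_flat`, in the tree).
-/

noncomputable section

namespace Literature.MathematicalPhysics.QuantumFieldTheory.Balaban1983to89.B8Prop3ShellModeVacuity

open Complex (I)
open B7Prop1Explicit B7Prop2Explicit B7Prop1Local MatrixLog
open B7Prop4GeneralLevels (linCovIter logCovIter linCovIter_zero logCovIter_zero logCovIter_one_left)
open B7Prop4Flat (C2 c4 C1_pos prop4_flat mlog_dbavgIter linQIter logIter)
open B9Eq316TowerFlatIsOneStep (linCovIter_one_left)
open B8Ineq132 (covDerivFwd BondTouches InAk Under inAk_gaugeAct_iff)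
open B8Eq140Level (SideTouches sideTouches_of_bondTouches)
open B8Eq146AExpansion (iEta)
open B8ScaledSupNorm (msup weight Bdd)
open B8Eq138LandauZd (IsLandau138 IsLandau138W covLap covDivB QT logCfg)
open B8Eq184Proof (cfgExp)
open B8Lemma1NonAbelian (mulCfg)
open B8Eq131Cubes (cube sqLo sqHi mem_cube_iff cube_succ_subset)
open B8Eq131CubesAdmissible (cubeFam cubeFam_true_zero cubeFam_of_pos smul_mem_cube_iff)
open B8CubeMemberZd (smul_mem_bondBox smul_add_mem_bondBox)
open B8IdxB8LawsB (towerBonds IdxB8LawsB IdxB8SubB)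
open B8LeafModelZd (ZdIdx)
open B8LeafModelZd3 (zdGF3 mlogCfg mlogCfg_of_sideTouches)
open B8LeafModelZd3H (zdGF3H)
open B8Eq191FlatStencils (covDerivFwd_flat_apply)
open B8Eq191FlatLettersCubeMember (inBox_finite)
open B9SupplySockB9P3ZdSocketBoundaryMode (isSelfAdjoint_real_smul_one cfgExp_mem_unitaryUnits expUnit_skew_mem_unitaryUnits exists_ne_fin
  logCfg_cfgExp_of_small)
open B8SockB9P3ShellModeVacuityUniv (exists_real_shellMode shellMode_postcomp grad_eq_zero_of_notMem isLandau138_univ_of_shellMode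
  linCovIter_one_grad_level_one towerBonds_one_ends towerBonds_zero_ends cfgExp_grad_eq_gaugeAct_of_commute exists_topCube_member_lawsB)
open Node00 (Stage3Params famB8OfRecordSubBH B8LeafOfRecordSubBH ResidB8)

-- `Site` alone could resolve to the torus sites of `Setup.lean`; re-export the `ℤ^d` sites of `B7Prop1Explicit`.
export B7Prop1Explicit (Site)

variable {d : ℕ}

/-! ## §1 [B7] Prop. 4 at `U₀ = 1`, one averaging step: the composite minus its linear part is second order -/

section Remainder

variable {𝔸 : Type*} [NormedRing 𝔸] [NormedAlgebra ℂ 𝔸] [CompleteSpace 𝔸] [NormOneClass 𝔸]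

/-- **[B7] PROP. 4 AT THE FLAT BACKGROUND, ONE STEP** ((133)–(135): «|C_k(U₀, A)| ≤ C₂|A|²» at `U₀ = 1`, `k = 1`): for a bond field `B` with
`‖B‖ ≤ b` and `L·b ≤ c₄(d)`, the level-`1` composite `Q₁(1, B)(c)` (`B7Prop4GeneralLevels.logCovIter`) differs from its linear part
`Q₁(1)B(c)` (`linCovIter`) by at most `C₂(d)·(L·b)²`, hence `‖Q₁(1, B)(c)‖ ≤ ‖Q₁(1)B(c)‖ + C₂(d)(Lb)²`.  BY NAME: `B7Prop4Flat.prop4_flat` ∕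
`mlog_dbavgIter` (flat iterates), `logCovIter_one_left`, `B9Eq316TowerFlatIsOneStep.linCovIter_one_left`.
[cite: Balaban1985Averaging, Prop. 4 (133)–(135) pp.38–39, (127) p.37] -/
theorem norm_logCovIter_one_one_le {L : ℕ} (hL : 2 ≤ L) (B : Site d → Fin d → 𝔸) {b : ℝ} (hb : 0 ≤ b)
    (hB : ∀ x κ, ‖B x κ‖ ≤ b) (hLb : (L : ℝ) * b ≤ c4 d) (z : Site d) (κ : Fin d) :
    ‖logCovIter L (1 : Site d → Fin d → 𝔸ˣ) B 1 z κ‖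
      ≤ ‖linCovIter L (1 : Site d → Fin d → 𝔸ˣ) B 1 z κ‖ + C2 d * ((L : ℝ) * b) ^ 2 := by
  have hL1 : 1 ≤ L := le_trans (by norm_num) hL
  have hLb1 : (L : ℝ) ^ 1 * b ≤ c4 d := by rwa [pow_one]
  have hLb0 : (L : ℝ) ^ (0 + 1) * b ≤ c4 d := by rwa [zero_add]
  have h := (prop4_flat L hL B hb hB 1 le_rfl hLb1 z κ).1
  rw [mlog_dbavgIter L hL B hb hB 0 hLb0 z κ, zero_add, pow_one] at h
  have hlog : logCovIter L (1 : Site d → Fin d → 𝔸ˣ) B 1 z κ = logIter L B 1 z κ := by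
    rw [logCovIter_one_left]
  have hlin : linCovIter L (1 : Site d → Fin d → 𝔸ˣ) B 1 z κ = linQIter L B 1 z κ := by
    rw [linCovIter_one_left L hL1 B hb hB 1]
  rw [hlog, hlin]
  calc ‖logIter L B 1 z κ‖ = ‖linQIter L B 1 z κ + (logIter L B 1 z κ - linQIter L B 1 z κ)‖ := by rw [add_sub_cancel]
    _ ≤ ‖linQIter L B 1 z κ‖ + ‖logIter L B 1 z κ - linQIter L B 1 z κ‖ := norm_add_le _ _
    _ ≤ ‖linQIter L B 1 z κ‖ + C2 d * ((L : ℝ) * b) ^ 2 := by linarith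

end Remainder

/-! ## §2 Proposition 3 AS TYPED is false at the `k = 1` shell member `(T, □₁)` -/

section Member

variable {𝔸 : Type} [CStarAlgebra 𝔸] [Nontrivial 𝔸]

set_option maxHeartbeats 800000 in
/-- ★★ **PROPOSITION 3 AS TYPED ON `zdGF3` IS FALSE AT THE `k = 1` SHELL MEMBER** — for a member `i : ZdIdx d L` with `i.k = 1`, `Ω 0 = ℤᵈ`,
`Ω 1 = □₁`, `Λs 1 0 = ℤᵈ ∖ □₁`, `Λs 1 1 = □₁⁽¹⁾`, `Λb 1 = towerBonds` (law №12), and EVERY `c > 0`, `C₂`, `inp`, `B₀β`, `β`, `len`: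
`¬ B8.Prop3Body c d L C₂ inp B₀β (fun _ : Unit => (zdGF3 𝔸 L β len i).toGFData2)` (`d, L ≥ 2`, `ρ ≥ 1`).  Witness: `U₀ = 1`, `U₁ = e^{iηt∂λ₁}`
(`λ₁` the real unit shell mode), schedule `α₀ = α₂²`, `α₁ = (C₂(d) + 2|C₂| + 3)α₂²`, `α₂` small — module docstring.  The (1.42) hypothesis is met
on the typed class (no crossing bond; linear part of the composite zero, [B7] Prop. 4 remainder second order), the conclusion (1.36)₁ fails at
the jump bond of `λ₁`. [cite: Balaban1985RegularSpaces, Prop. 3 p.87, (1.40)–(1.42) p.83, (1.61)–(1.62) pp.86–87, (1.31) p.82, (1.36) p.82, (1.131) p.99; Balaban1985Averaging, Prop. 4 (133)–(135) pp.38–39] -/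
theorem not_prop3Body_zdGF3_topCube (hd2 : 2 ≤ d) {L : ℕ} (hL : 2 ≤ L) (i : ZdIdx d L) (hk1 : i.k = 1) {a : Site d} {M ρ : ℕ}
    (hρ : 1 ≤ ρ) (hΩ0 : i.Ω 0 = Set.univ) (hΩ1 : i.Ω 1 = cube L a M ρ i.k 1)
    (hΛ0 : i.Λs 1 0 = (cube L a M ρ i.k 1)ᶜ) (hΛ1 : i.Λs 1 1 = {z | InBox (sqLo L a ρ i.k 1) (sqHi L a M ρ i.k 1) z})
    (hΛb : ∀ j, i.Λb 1 j = towerBonds L i.Ω (i.Λs 1) j)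
    {c : ℝ} (hc : 0 < c) (C₂ : ℝ) (inp : B8.B9Inputs) (B₀β β : ℝ) (len : Site d → ℝ) :
    ¬ B8.Prop3Body c d (L : ℝ) C₂ inp B₀β (fun _ : Unit => (zdGF3 𝔸 L β len i).toGFData2) := by
  classical
  intro H
  have hη : 0 < i.η := i.hη
  have hL1 : 1 ≤ L := le_trans (by norm_num) hL
  have hLr : (1 : ℝ) ≤ L := by exact_mod_cast hL1
  have hLr2 : (2 : ℝ) ≤ L := by exact_mod_cast hL
  have hL0 : (0 : ℝ) < L := by linarith
  have hdr : (2 : ℝ) ≤ d := by exact_mod_cast hd2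
  have hηne : i.η ≠ 0 := hη.ne'
  have hB₀ : 0 < inp.B₀ := inp.B₀_pos
  -- THE UNIT REAL SHELL MODE `λ₁` and its jump bond `⟨y₀, y₀ + e₀⟩`
  obtain ⟨Λ₀, hΛ₀, hmode⟩ := exists_real_shellMode hL1 i.η a M hρ i.k
  obtain ⟨lam₁, hreal₁, hsupp₁, ⟨x₀, hx₀⟩, hbdd₁, hsum₁, hlan₁⟩ := hmode 1 one_ne_zero
  have hlamb₁ : ∀ x, ‖lam₁ x‖ ≤ Λ₀ := fun x => by simpa using hbdd₁ x
  set τ₀ : Fin d := ⟨0, by omega⟩ with hτ₀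
  have hP' : ∃ s : ℕ, lam₁ (x₀ + ((s + 1 : ℕ) : ℤ) • e τ₀) = 0 := by
    by_contra hall
    push Not at hall
    have hmem : ∀ s : ℕ, x₀ + ((s + 1 : ℕ) : ℤ) • e τ₀ ∈ cube L a M ρ i.k 1 := fun s => by
      by_contra h; exact hall s (hsupp₁ _ h)
    have hinj : Function.Injective (fun s : ℕ => x₀ + ((s + 1 : ℕ) : ℤ) • e τ₀) := by
      intro s s' h
      have := congrFun h τ₀
      simp only [Pi.add_apply, Pi.smul_apply, smul_eq_mul, e, Pi.single_eq_same, mul_one, add_right_inj] at this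
      omega
    have hfin : (cube L a M ρ i.k 1).Finite := inBox_finite _ _
    exact (Set.infinite_range_of_injective hinj) (hfin.subset (by rintro _ ⟨s, rfl⟩; exact hmem s))
  obtain ⟨s₀, hs₀, hmin⟩ : ∃ s₀ : ℕ, lam₁ (x₀ + ((s₀ + 1 : ℕ) : ℤ) • e τ₀) = 0 ∧ lam₁ (x₀ + (s₀ : ℤ) • e τ₀) ≠ 0 := by
    refine ⟨Nat.find hP', Nat.find_spec hP', ?_⟩
    rcases Nat.eq_zero_or_pos (Nat.find hP') with h0 | hpos
    · rw [h0]; simpa using hx₀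
    · have := Nat.find_min hP' (m := Nat.find hP' - 1) (by omega)
      rwa [show Nat.find hP' - 1 + 1 = Nat.find hP' by omega] at this
  set y₀ : Site d := x₀ + (s₀ : ℤ) • e τ₀ with hy₀
  have hy₀e : y₀ + e τ₀ = x₀ + ((s₀ + 1 : ℕ) : ℤ) • e τ₀ := by
    rw [hy₀]; push_cast; rw [add_smul, one_smul, add_assoc]
  obtain ⟨m₀, hm₀_def⟩ : ∃ m₀ : ℝ, m₀ = ‖lam₁ y₀‖ := ⟨_, rfl⟩
  have hm₀ : 0 < m₀ := by rw [hm₀_def]; exact norm_pos_iff.2 hmin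
  -- THE CONSTANTS OF THE SCHEDULE
  obtain ⟨M₁, hM₁_def⟩ : ∃ M₁ : ℝ, M₁ = Λ₀ + Λ₀ + 1 := ⟨_, rfl⟩
  have hM₁0 : 0 < M₁ := by rw [hM₁_def]; positivity
  obtain ⟨K', hK'_def⟩ : ∃ K' : ℝ, K' = C2 d + 2 * |C₂| + 3 := ⟨_, rfl⟩
  have hC2 : 0 < C2 d := by unfold C2; have := C1_pos d; positivity
  have hK'0 : 0 < K' := by rw [hK'_def]; positivity
  obtain ⟨Q, hQ_def⟩ : ∃ Q : ℝ, Q = 5 * (d : ℝ) * L * inp.B₀ * (1 + K') * M₁ * L := ⟨_, rfl⟩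
  have hQ0 : 0 < Q := by rw [hQ_def]; positivity
  have hc4 : 0 < c4 d := by unfold c4; have := C1_pos d; positivity
  -- `α₂` and the derived `α₀ = α₂²`, `α₁ = K′α₂²`, `t = α₂ ∕ (M₁L)`
  obtain ⟨α₂, hα₂_def⟩ : ∃ α₂ : ℝ, α₂ = min c (min (1 / 16) (min (1 / (20 * (d : ℝ))) (min (c / K') (min (c4 d) (m₀ / (2 * Q)))))) := ⟨_, rfl⟩
  have hα₂ : 0 < α₂ := by
    rw [hα₂_def]
    refine lt_min hc (lt_min (by norm_num) (lt_min (by positivity) (lt_min (by positivity) (lt_min hc4 (by positivity)))))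
  have hα₂c : α₂ ≤ c := by rw [hα₂_def]; exact min_le_left _ _
  have hα₂16 : α₂ ≤ 1 / 16 := by rw [hα₂_def]; exact (min_le_right _ _).trans (min_le_left _ _)
  have hα₂d : α₂ ≤ 1 / (20 * (d : ℝ)) := by
    rw [hα₂_def]; exact (min_le_right _ _).trans ((min_le_right _ _).trans (min_le_left _ _))
  have hα₂K : α₂ ≤ c / K' := by
    rw [hα₂_def]; exact (min_le_right _ _).trans ((min_le_right _ _).trans ((min_le_right _ _).trans (min_le_left _ _)))
  have hα₂c4 : α₂ ≤ c4 d := by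
    rw [hα₂_def]
    exact (min_le_right _ _).trans ((min_le_right _ _).trans ((min_le_right _ _).trans ((min_le_right _ _).trans (min_le_left _ _))))
  have hα₂Q : α₂ ≤ m₀ / (2 * Q) := by
    rw [hα₂_def]
    exact (min_le_right _ _).trans ((min_le_right _ _).trans ((min_le_right _ _).trans ((min_le_right _ _).trans (min_le_right _ _))))
  have hα₂1 : α₂ ≤ 1 := hα₂16.trans (by norm_num)
  have hα₂sq : α₂ ^ 2 ≤ α₂ := by nlinarith
  have h20 : 20 * (d : ℝ) * α₂ ≤ 1 := by
    have hd0 : (0 : ℝ) < 20 * (d : ℝ) := by positivity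
    have := (le_div_iff₀ hd0).1 hα₂d
    linarith
  obtain ⟨α₀, hα₀_def⟩ : ∃ α₀ : ℝ, α₀ = α₂ ^ 2 := ⟨_, rfl⟩
  obtain ⟨α₁, hα₁_def⟩ : ∃ α₁ : ℝ, α₁ = K' * α₂ ^ 2 := ⟨_, rfl⟩
  have hα₀ : 0 < α₀ := by rw [hα₀_def]; positivity
  have hα₁ : 0 < α₁ := by rw [hα₁_def]; positivity
  have hα₀c : α₀ ≤ c := by rw [hα₀_def]; exact hα₂sq.trans hα₂c
  have hα₁c : α₁ ≤ c := by
    rw [hα₁_def]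
    have h1 : K' * α₂ ^ 2 ≤ K' * α₂ := mul_le_mul_of_nonneg_left hα₂sq hK'0.le
    have h2 : K' * α₂ ≤ c := by
      have := (le_div_iff₀ hK'0).1 hα₂K
      linarith
    exact h1.trans h2
  have h61 : 2 * α₂ ^ 2 + 20 * d * α₀ * α₂ + 2 * C₂ * α₂ ^ 2 ≤ α₀ + α₁ := by
    rw [hα₀_def, hα₁_def, hK'_def]
    have hsq : 0 ≤ α₂ ^ 2 := sq_nonneg _
    have h3 : 20 * (d : ℝ) * α₂ ^ 2 * α₂ ≤ α₂ ^ 2 := by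
      have := mul_le_mul_of_nonneg_right h20 hsq
      nlinarith
    have h4 : 2 * C₂ * α₂ ^ 2 ≤ 2 * |C₂| * α₂ ^ 2 := by
      have := le_abs_self C₂
      nlinarith
    nlinarith
  set t : ℝ := α₂ / (M₁ * L) with ht_def
  have ht0 : 0 < t := by rw [ht_def]; positivity
  have htM : t * M₁ = α₂ / L := by rw [ht_def]; field_simp
  have htML : t * M₁ * L = α₂ := by rw [htM]; field_simp
  -- THE SCALED MODE `λ := t·λ₁` (via an `ℝ`-linear post-composition, to reuse the structural lemmas)
  let g : ℂ →ₗ[ℝ] ℂ := t • LinearMap.id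
  have hg : ∀ z : ℂ, g z = (t : ℂ) * z := fun z => by
    simp [g, Complex.real_smul]
  obtain ⟨hsupp, hsum, hlan⟩ := shellMode_postcomp g hsupp₁ hsum₁ hlan₁
  set lam : Site d → ℂ := fun w => g (lam₁ w) with hlam_def
  have hlam : ∀ w, lam w = (t : ℂ) * lam₁ w := fun w => hg _
  have hreal : ∀ x, ((lam x).re : ℂ) = lam x := by
    intro x
    rw [hlam, ← hreal₁ x]
    simp [Complex.ofReal_re, Complex.mul_re]
  have habs : |t| = t := abs_of_pos ht0
  have hlamb : ∀ x, ‖lam x‖ ≤ t * Λ₀ := by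
    intro x
    rw [hlam, norm_mul, Complex.norm_real, Real.norm_eq_abs, habs]
    exact mul_le_mul_of_nonneg_left (hlamb₁ x) ht0.le
  -- the `ℂ`-valued gradient `φ = ∂λ` and its `𝔸`-valued copy `A′ = φ • 1`
  set φ : Site d → Fin d → ℂ := fun y τ => covDerivFwd i.η (1 : Site d → Fin d → ℂˣ) τ lam y with hφdef
  have hφ : ∀ y τ, φ y τ = i.η⁻¹ • (lam (y + e τ) - lam y) := fun y τ => covDerivFwd_flat_apply i.η τ lam y
  have hφbd : ∀ y τ, ‖φ y τ‖ ≤ i.η⁻¹ * (t * Λ₀ + t * Λ₀) := fun y τ =>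
    B8Ineq159FlatMaps.norm_covDerivFwd_flat_le hη hlamb τ y
  have hφT : ∀ y τ, ‖φ y τ‖ ≤ i.η⁻¹ * (t * M₁) := by
    intro y τ
    refine (hφbd y τ).trans (mul_le_mul_of_nonneg_left ?_ (inv_nonneg.2 hη.le))
    rw [hM₁_def]; nlinarith
  -- the value at the jump bond: `‖φ(y₀, e₀)‖ = η⁻¹·t·m₀`
  have hφy₀ : ‖φ y₀ τ₀‖ = i.η⁻¹ * (t * m₀) := by
    rw [hφ, hy₀e, hlam, hlam, hs₀, mul_zero, zero_sub, norm_smul, norm_neg, norm_mul, Complex.norm_real,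
      Real.norm_of_nonneg (inv_nonneg.2 hη.le), Real.norm_of_nonneg ht0.le, hm₀_def]
  let ι : ℂ →L[ℂ] 𝔸 := (ContinuousLinearMap.id ℂ ℂ).smulRight (1 : 𝔸)
  have hι : ∀ z : ℂ, ι z = z • (1 : 𝔸) := fun z => rfl
  set lamA : Site d → 𝔸 := fun x => ι (i.η⁻¹ • lam x) with hlamA
  set A' : Site d → Fin d → 𝔸 := fun y τ => ι (φ y τ) with hA'
  have hA'g : A' = fun y τ => lamA (y + e τ) - lamA y := by
    funext y τ
    simp only [hA', hlamA, hφ, smul_sub, map_sub]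
  have hA'norm : ∀ y τ, ‖A' y τ‖ = ‖φ y τ‖ := fun y τ => by
    show ‖ι (φ y τ)‖ = ‖φ y τ‖
    rw [hι, norm_smul, norm_one, mul_one]
  have hA'sa : ∀ y τ, IsSelfAdjoint (A' y τ) := by
    intro y τ
    have : φ y τ = (((φ y τ).re : ℝ) : ℂ) := by
      rw [hφ, ← hreal (y + e τ), ← hreal y]
      simp [Complex.ofReal_re, Complex.sub_re]
    show IsSelfAdjoint (ι (φ y τ))
    rw [hι, this]
    exact isSelfAdjoint_real_smul_one _
  have hlamA_sa : ∀ x, IsSelfAdjoint ((i.η : ℝ) • lamA x) := by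
    intro x
    show IsSelfAdjoint ((i.η : ℝ) • ι (i.η⁻¹ • lam x))
    rw [hι, ← hreal x]
    rw [show i.η⁻¹ • (((lam x).re : ℝ) : ℂ) = (((i.η⁻¹ * (lam x).re : ℝ)) : ℂ) by push_cast; rw [Complex.real_smul]; push_cast; ring]
    exact IsSelfAdjoint.smul (IsSelfAdjoint.all i.η) (isSelfAdjoint_real_smul_one _)
  have hcomm : ∀ u v, Commute (lamA u) (lamA v) := fun u v => by
    show Commute (ι (i.η⁻¹ • lam u)) (ι (i.η⁻¹ • lam v))
    rw [hι, hι]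
    exact (Commute.one_right _).smul_right _
  -- the bound (1.41): `‖A′‖ ≤ η⁻¹·tM₁ = α₂(Lη)⁻¹ ≤ α₂(Lʲη)⁻¹`, `j ≤ 1`
  have hA'bd : ∀ y τ, ‖A' y τ‖ ≤ α₂ * ((L : ℝ) * i.η)⁻¹ := by
    intro y τ
    rw [hA'norm]
    refine (hφT y τ).trans (le_of_eq ?_)
    rw [htM]; field_simp
  have hA'bdj : ∀ j, j ≤ i.k → ∀ y τ, ‖A' y τ‖ ≤ α₂ * ((L : ℝ) ^ j * i.η)⁻¹ := by
    intro j hj y τ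
    rw [hk1] at hj
    refine (hA'bd y τ).trans (mul_le_mul_of_nonneg_left ?_ hα₂.le)
    refine inv_anti₀ (by positivity) (mul_le_mul_of_nonneg_right ?_ hη.le)
    calc (L : ℝ) ^ j ≤ (L : ℝ) ^ 1 := pow_le_pow_right₀ hLr hj
      _ = L := pow_one _
  have hηA' : ∀ y τ, i.η * ‖A' y τ‖ ≤ 1 / 2 := by
    intro y τ
    calc i.η * ‖A' y τ‖ ≤ i.η * (α₂ * ((L : ℝ) * i.η)⁻¹) := mul_le_mul_of_nonneg_left (hA'bd y τ) hη.le
      _ = α₂ / L := by field_simp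
      _ ≤ α₂ / 1 := div_le_div_of_nonneg_left hα₂.le one_pos hLr
      _ ≤ 1 / 2 := by rw [div_one]; linarith
  -- the pure gauge `W = e^{iηA′}`, its class, `(iη)⁻¹ log W = A′`
  set W : Site d → Fin d → 𝔸ˣ := cfgExp i.η A' with hW
  have h1u : ∀ x κ, (1 : Site d → Fin d → 𝔸ˣ) x κ ∈ unitaryUnits 𝔸 := fun _ _ => (unitaryUnits 𝔸).one_mem
  have hWu : ∀ x κ, W x κ ∈ unitaryUnits 𝔸 := fun x κ => cfgExp_mem_unitaryUnits i.η hA'sa x κ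
  have hA1 : InAk L i.k i.η α₀ i.Ω (1 : Site d → Fin d → 𝔸ˣ) := B8Prop6OfThm4.one_inAk hL1 i.k hη hα₀ i.Ω
  have hAW : InAk L i.k i.η α₀ i.Ω (mulCfg W 1) := by
    rw [B8Thm4Concrete.mulCfg_eq_mul, mul_one, hW, hA'g, cfgExp_grad_eq_gaugeAct_of_commute i.η lamA hcomm]
    exact (inAk_gaugeAct_iff L i.k i.η α₀ i.Ω (fun x => unitaryUnits_le_U1 (expUnit_skew_mem_unitaryUnits (hlamA_sa x))) 1).2 hA1
  have hlogW : logCfg i.η W = A' := by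
    have hsmall : ∀ (y : Site d) (τ : Fin d), i.η * ‖A' y τ‖ < Real.log 2 := fun y τ =>
      lt_of_le_of_lt (hηA' y τ) (by have h := Real.log_two_gt_d9; norm_num at h ⊢; linarith)
    rw [hW, logCfg_cfgExp_of_small hη hsmall]
  -- the Landau condition of record (truncation `k = 1`)
  have hLanC : IsLandau138 L 1 i.η (i.Ω 0) (i.Λs 1) (1 : Site d → Fin d → ℂˣ) φ := by
    rw [hΩ0]
    exact isLandau138_univ_of_shellMode hL1 i.η hρ (by omega) hsupp hlan hΛ0 hΛ1
  have hLanA : IsLandau138 L 1 i.η (i.Ω 0) (i.Λs 1) (1 : Site d → Fin d → 𝔸ˣ) A' :=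
    B8Ineq159FlatMaps.isLandau138_map_flat ι hLanC
  have hLan : IsLandau138W L i.k i.η (i.Ω 0) (i.Λs i.k) 1 W := by
    rw [hk1]
    unfold IsLandau138W
    rw [hlogW]
    exact hLanA
  -- every bond touches `Ω₀ = ℤᵈ`, so the masked exponent is `A′` everywhere
  have hside0 : ∀ (y : Site d) (τ : Fin d), SideTouches (i.Ω 0) y τ := by
    intro y τ
    obtain ⟨κ', hκ'⟩ := exists_ne_fin hd2 τ
    exact sideTouches_of_bondTouches hκ' (Or.inl (by rw [hΩ0]; exact Set.mem_univ y))
  have hmlog : mlogCfg i.k i.η i.Ω W = A' := by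
    funext y τ
    rw [mlogCfg_of_sideTouches i.η W (Nat.zero_le _) (hside0 y τ), hlogW]
  -- (1.41) `C162 1 α₂`
  have h162 : ∀ j, j ≤ i.k → ∀ b ∈ {b : Site d × Fin d | SideTouches (i.Ω j) b.1 b.2},
      W b.1 b.2 = cfgExp i.η (logCfg i.η W) b.1 b.2 ∧ IsSelfAdjoint (logCfg i.η W b.1 b.2) ∧
        ‖logCfg i.η W b.1 b.2‖ ≤ 1 * α₂ * ((L : ℝ) ^ j * i.η)⁻¹ := by
    intro j hj b _
    rw [hlogW, one_mul]
    exact ⟨rfl, hA'sa b.1 b.2, hA'bdj j hj b.1 b.2⟩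
  -- (1.42) `C137 α₁` on the TYPED class `towerBonds` (no crossing bond)
  have hB : ∀ w ν, ‖iEta i.η A' w ν‖ ≤ t * M₁ := by
    intro w ν
    refine (B8Eq146AExpansion.norm_iEta_le hη.le (fun y τ => (hA'norm y τ).le.trans (hφT y τ)) w ν).trans (le_of_eq ?_)
    field_simp
  have hφB : ∀ w ν, ‖iEta i.η φ w ν‖ ≤ t * M₁ := by
    intro w ν
    refine (B8Eq146AExpansion.norm_iEta_le hη.le hφT w ν).trans (le_of_eq ?_)
    field_simp
  have htM0 : 0 ≤ t * M₁ := by positivity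
  have hφ0 : ∀ y τ, y ∉ cube L a M ρ i.k 1 → y + e τ ∉ cube L a M ρ i.k 1 → φ y τ = 0 := fun y τ hy hy' =>
    grad_eq_zero_of_notMem hsupp hy hy'
  have h137 : ∀ j, j ≤ i.k → ∀ cc ∈ i.Λb i.k j,
      ‖logCovIter L (1 : Site d → Fin d → 𝔸ˣ) (iEta i.η (mlogCfg i.k i.η i.Ω W)) j cc.1 cc.2‖ < 2 * d * L * α₁ := by
    rw [hmlog, hk1]
    intro j hj cc hcc
    rw [hΛb] at hcc
    rcases Nat.le_one_iff_eq_zero_or_eq_one.mp hj with rfl | rfl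
    · -- level 0: both ends off `□₁`, `A′ = 0` there
      obtain ⟨hy, hy'⟩ := towerBonds_zero_ends hΛ0 hcc
      rw [logCovIter_zero]
      have : iEta i.η A' cc.1 cc.2 = 0 := by
        simp [B8Eq146AExpansion.iEta_def, hA', hφ0 cc.1 cc.2 hy hy']
      rw [this, norm_zero]
      positivity
    · -- level 1: both blocks inside `□₁`; linear part zero (equal block sums), [B7] Prop. 4 remainder second order
      obtain ⟨hz, hz'⟩ := towerBonds_one_ends hL1 hΩ1 hcc
      have hιA : ∀ w ν, ι (iEta i.η φ w ν) = iEta i.η A' w ν := fun w ν => by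
        simp only [B8Eq146AExpansion.iEta_def, hA', map_smul]
      have hmap := B8Ineq159FlatMaps.map_linCovIter_flat ι hL1 (iEta i.η φ) htM0 hφB 1 cc.1 cc.2
      simp only [hιA] at hmap
      have hlin0 : linCovIter L (1 : Site d → Fin d → 𝔸ˣ) (iEta i.η A') 1 cc.1 cc.2 = 0 := by
        rw [← hmap, linCovIter_one_grad_level_one hL1 hη hlamb cc.1 cc.2, hsum (cc.1 + e cc.2) cc.1 hz' hz, sub_self, mul_zero,
          smul_zero, map_zero]
      have hLb : (L : ℝ) * (t * M₁) ≤ c4 d := by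
        rw [show (L : ℝ) * (t * M₁) = α₂ by rw [← htML]; ring]; exact hα₂c4
      have hrem := norm_logCovIter_one_one_le hL (iEta i.η A') htM0 hB hLb cc.1 cc.2
      rw [hlin0, norm_zero, zero_add, show (L : ℝ) * (t * M₁) = α₂ by rw [← htML]; ring] at hrem
      refine lt_of_le_of_lt hrem ?_
      -- `C₂(d)α₂² < 2dL·K′α₂²`
      rw [hα₁_def, hK'_def]
      have hsq : 0 < α₂ ^ 2 := by positivity
      have hdL : (4 : ℝ) ≤ 2 * (d : ℝ) * L := by nlinarith
      have habs : 0 ≤ |C₂| := abs_nonneg _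
      have hv : 0 ≤ C2 d + 2 * |C₂| + 3 := by positivity
      have h4v : 4 * (C2 d + 2 * |C₂| + 3) ≤ 2 * (d : ℝ) * L * (C2 d + 2 * |C₂| + 3) := mul_le_mul_of_nonneg_right hdL hv
      have hK1 : C2 d + 1 ≤ 2 * (d : ℝ) * L * (C2 d + 2 * |C₂| + 3) := by linarith
      have hstep : (C2 d + 1) * α₂ ^ 2 ≤ 2 * (d : ℝ) * L * (C2 d + 2 * |C₂| + 3) * α₂ ^ 2 :=
        mul_le_mul_of_nonneg_right hK1 hsq.le
      calc C2 d * α₂ ^ 2 < (C2 d + 1) * α₂ ^ 2 := by nlinarith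
        _ ≤ 2 * (d : ℝ) * L * (C2 d + 2 * |C₂| + 3) * α₂ ^ 2 := hstep
        _ = 2 * (d : ℝ) * L * ((C2 d + 2 * |C₂| + 3) * α₂ ^ 2) := by ring
  -- PROPOSITION 3 AS TYPED, applied to this datum
  have hP := H () α₀ α₁ α₂ hα₀ hα₀c hα₁ hα₁c hα₂ hα₂c h61 ⟨1, h1u⟩ (⟨1, h1u⟩, ⟨W, hWu⟩) hA1 trivial hAW h162 hLan h137
  obtain ⟨⟨h136, -, -⟩, -⟩ := hP
  obtain ⟨-, -, hbd⟩ := h136 0 (Nat.zero_le _) (y₀, τ₀) (hside0 y₀ τ₀)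
  -- the conclusion (1.36)₁ at the jump bond: `η⁻¹·t·m₀ ≤ 5dLB₀(α₀ + α₁)η⁻¹`
  rw [hlogW, pow_zero, one_mul, hA'norm, hφy₀] at hbd
  have hbd' : t * m₀ ≤ 5 * (d : ℝ) * L * inp.B₀ * (α₀ + α₁) := by
    have h1 := mul_le_mul_of_nonneg_left hbd hη.le
    have e1 : i.η * (i.η⁻¹ * (t * m₀)) = t * m₀ := by field_simp
    have e2 : i.η * (5 * (d : ℝ) * L * inp.B₀ * (α₀ + α₁) * i.η⁻¹) = 5 * (d : ℝ) * L * inp.B₀ * (α₀ + α₁) := by field_simp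
    rw [e1, e2] at h1
    exact h1
  -- i.e. `m₀ ≤ Q·α₂`, contradicting `α₂ ≤ m₀ ∕ (2Q)`
  have hQα : m₀ ≤ Q * α₂ := by
    rw [hα₀_def, hα₁_def, ht_def] at hbd'
    have hML : 0 < M₁ * L := by positivity
    have h1 : α₂ * m₀ ≤ 5 * (d : ℝ) * L * inp.B₀ * (α₂ ^ 2 + K' * α₂ ^ 2) * (M₁ * L) := by
      have h := mul_le_mul_of_nonneg_right hbd' hML.le
      have e : α₂ / (M₁ * L) * m₀ * (M₁ * L) = α₂ * m₀ := by field_simp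
      rw [e] at h
      exact h
    have h2 : 5 * (d : ℝ) * L * inp.B₀ * (α₂ ^ 2 + K' * α₂ ^ 2) * (M₁ * L) = Q * α₂ * α₂ := by rw [hQ_def]; ring
    rw [h2] at h1
    have h3 : m₀ * α₂ ≤ Q * α₂ * α₂ := by rw [mul_comm]; exact h1
    exact le_of_mul_le_mul_right h3 hα₂
  have hfin : Q * α₂ ≤ m₀ / 2 := by
    have := mul_le_mul_of_nonneg_left hα₂Q hQ0.le
    rw [show Q * (m₀ / (2 * Q)) = m₀ / 2 by field_simp] at this
    exact this
  linarith

/-- ★★ **… hence `B8.Prop3Printed` (any threshold) is false there.** [cite: Balaban1985RegularSpaces, Prop. 3 p.87] -/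
theorem not_prop3Printed_zdGF3_topCube (hd2 : 2 ≤ d) {L : ℕ} (hL : 2 ≤ L) (i : ZdIdx d L) (hk1 : i.k = 1) {a : Site d} {M ρ : ℕ}
    (hρ : 1 ≤ ρ) (hΩ0 : i.Ω 0 = Set.univ) (hΩ1 : i.Ω 1 = cube L a M ρ i.k 1)
    (hΛ0 : i.Λs 1 0 = (cube L a M ρ i.k 1)ᶜ) (hΛ1 : i.Λs 1 1 = {z | InBox (sqLo L a ρ i.k 1) (sqHi L a M ρ i.k 1) z})
    (hΛb : ∀ j, i.Λb 1 j = towerBonds L i.Ω (i.Λs 1) j)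
    (C₂ : ℝ) (inp : B8.B9Inputs) (B₀β β : ℝ) (len : Site d → ℝ) :
    ¬ B8.Prop3Printed d (L : ℝ) C₂ inp B₀β (fun _ : Unit => (zdGF3 𝔸 L β len i).toGFData2) := by
  rintro ⟨c, hc, H⟩
  exact not_prop3Body_zdGF3_topCube hd2 hL i hk1 hρ hΩ0 hΩ1 hΛ0 hΛ1 hΛb hc C₂ inp B₀β β len H

end Member

/-! ## §3 At the record: the sub-family over `IdxB8SubB θ` contains the shell member, so the slot is uninhabited -/

section Record

variable {θ : Stage3Params}

/-- ★★★ **PROPOSITION 3 AS TYPED ON THE RECORD's [B8] SUB-FAMILY IS FALSE** (`θ.D ≥ 2`; every `C₂ inp B₀β β len`): the sub-index of record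
`IdxB8SubB θ` contains print's `(T, □₁)` family with `k = 1`, `η = L⁻¹` as a LAWFUL member (`exists_topCube_member_lawsB`: laws №7∕8∕11∕12), at
which §2 applies; the record's carrier `famB8OfRecordSubBH θ β len j = zdGF3H … j.1.1` has the same `GFData2` part as `zdGF3`.
[cite: Balaban1985RegularSpaces, Prop. 3 p.87, (1.42) p.83, (1.31) p.82, (1.131) p.99] -/
theorem not_prop3Printed_famB8OfRecordSubBH (hD : 2 ≤ θ.D) (C₂ : ℝ) (inp : B8.B9Inputs) (B₀β β : ℝ) (len : Site θ.D → ℝ) :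
    ¬ B8.Prop3Printed θ.D (θ.L : ℝ) C₂ inp B₀β (fun j : IdxB8SubB θ => (famB8OfRecordSubBH θ β len j).toGFData2) := by
  have hL : 1 ≤ θ.L := le_trans (by norm_num) θ.two_le_L
  have hη : (0 : ℝ) < ((θ.L : ℝ)⁻¹) ^ 1 := pow_pos (inv_pos.mpr (by exact_mod_cast (show 0 < θ.L by omega))) 1
  have hscale : (θ.L : ℝ) ^ 1 * ((θ.L : ℝ)⁻¹) ^ 1 ≤ 1 := by
    rw [pow_one, pow_one, mul_inv_cancel₀ (by exact_mod_cast (show θ.L ≠ 0 by omega))]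
  obtain ⟨i, hik, hiη, hΩ, hΛ0, hΛ1, hΛb, hlaws⟩ :=
    exists_topCube_member_lawsB (d := θ.D) hL (0 : Site θ.D) 1 (le_refl θ.L) (le_refl 1) hη hscale
  have hΩ0 : i.Ω 0 = Set.univ := by rw [hΩ]; exact cubeFam_true_zero θ.L 0 1 θ.L 1
  have hΩ1 : i.Ω 1 = cube θ.L 0 1 θ.L i.k 1 := by
    rw [hΩ, hik]; exact cubeFam_of_pos true θ.L 0 1 θ.L le_rfl le_rfl
  have hΛ0' : i.Λs 1 0 = (cube θ.L 0 1 θ.L i.k 1)ᶜ := by rw [hik]; exact hΛ0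
  have hΛ1' : i.Λs 1 1 = {z | InBox (sqLo θ.L 0 θ.L i.k 1) (sqHi θ.L 0 1 θ.L i.k 1) z} := by rw [hik]; exact hΛ1
  set jj : IdxB8SubB θ := ⟨⟨i, hΩ0⟩, hlaws⟩ with hjj
  rintro ⟨c, hc, H⟩
  refine not_prop3Body_zdGF3_topCube (𝔸 := θ.𝔸) hD θ.two_le_L i hik hL hΩ0 hΩ1 hΛ0' hΛ1' (fun j => hΛb 1 j) hc C₂ inp B₀β β len ?_
  intro _
  exact H jj

/-- ★★★ **THE N05 SLOT OF RECORD IS UNINHABITED AS TYPED**: for every Stage-3 parameter `θ` with `D ≥ 2` and EVERY residual layer `lam`,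
`¬ B8LeafOfRecordSubBH θ lam` — its `p3` field is §3's refuted sentence.  (A6 on the record's carrier; the repair is the carrier edition
«`C137` over print's class `towerBondsP`», planners' ∕ node00-def's.) [cite: Balaban1985RegularSpaces, Prop. 3 p.87, Lemma 1 – Thm 8 pp.79–101 (the slot)] -/
theorem not_b8LeafOfRecordSubBH (hD : 2 ≤ θ.D) (lam : ResidB8 θ) : ¬ B8LeafOfRecordSubBH θ lam :=
  fun h => not_prop3Printed_famB8OfRecordSubBH hD lam.C₂ lam.inp lam.B₀β lam.β lam.len h.p3

/-- ★★★ **THE SAME ON g31's LAW-FREE SUB-INDEX `IdxB8 θ`** (`famB8OfRecord θ β len j = zdGF3 … j.1`, ALL `Ω₀ = ℤᵈ` members — the shell member is one):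
Prop. 3 as typed on `famB8OfRecord` is FALSE (`θ.D ≥ 2`; every `C₂ inp B₀β β len`). [cite: Balaban1985RegularSpaces, Prop. 3 p.87, (1.42) p.83, (1.31) p.82, (1.131) p.99] -/
theorem not_prop3Printed_famB8OfRecord (hD : 2 ≤ θ.D) (C₂ : ℝ) (inp : B8.B9Inputs) (B₀β β : ℝ) (len : Site θ.D → ℝ) :
    ¬ B8.Prop3Printed θ.D (θ.L : ℝ) C₂ inp B₀β (fun j : Node00.IdxB8 θ => (Node00.famB8OfRecord θ β len j).toGFData2) := by
  have hL : 1 ≤ θ.L := le_trans (by norm_num) θ.two_le_L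
  have hη : (0 : ℝ) < ((θ.L : ℝ)⁻¹) ^ 1 := pow_pos (inv_pos.mpr (by exact_mod_cast (show 0 < θ.L by omega))) 1
  have hscale : (θ.L : ℝ) ^ 1 * ((θ.L : ℝ)⁻¹) ^ 1 ≤ 1 := by
    rw [pow_one, pow_one, mul_inv_cancel₀ (by exact_mod_cast (show θ.L ≠ 0 by omega))]
  obtain ⟨i, hik, hiη, hΩ, hΛ0, hΛ1, hΛb, hlaws⟩ :=
    exists_topCube_member_lawsB (d := θ.D) hL (0 : Site θ.D) 1 (le_refl θ.L) (le_refl 1) hη hscale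
  have hΩ0 : i.Ω 0 = Set.univ := by rw [hΩ]; exact cubeFam_true_zero θ.L 0 1 θ.L 1
  have hΩ1 : i.Ω 1 = cube θ.L 0 1 θ.L i.k 1 := by
    rw [hΩ, hik]; exact cubeFam_of_pos true θ.L 0 1 θ.L le_rfl le_rfl
  have hΛ0' : i.Λs 1 0 = (cube θ.L 0 1 θ.L i.k 1)ᶜ := by rw [hik]; exact hΛ0
  have hΛ1' : i.Λs 1 1 = {z | InBox (sqLo θ.L 0 θ.L i.k 1) (sqHi θ.L 0 1 θ.L i.k 1) z} := by rw [hik]; exact hΛ1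
  set jj : Node00.IdxB8 θ := ⟨i, hΩ0⟩ with hjj
  rintro ⟨c, hc, H⟩
  refine not_prop3Body_zdGF3_topCube (𝔸 := θ.𝔸) hD θ.two_le_L i hik hL hΩ0 hΩ1 hΛ0' hΛ1' (fun j => hΛb 1 j) hc C₂ inp B₀β β len ?_
  intro _
  exact H jj

/-- ★★★ **`Node00.B8LeafOfRecord θ lam` (g31's slot over `IdxB8 θ`) IS UNINHABITED AS TYPED** (`θ.D ≥ 2`, every `lam`). [cite: Balaban1985RegularSpaces, Prop. 3 p.87, Lemma 1 – Thm 8 pp.79–101 (the slot)] -/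
theorem not_b8LeafOfRecord (hD : 2 ≤ θ.D) (lam : ResidB8 θ) : ¬ Node00.B8LeafOfRecord θ lam :=
  fun h => not_prop3Printed_famB8OfRecord hD lam.C₂ lam.inp lam.B₀β lam.β lam.len h.p3

end Record

#print axioms not_prop3Body_zdGF3_topCube
#print axioms not_prop3Printed_famB8OfRecordSubBH
#print axioms not_b8LeafOfRecordSubBH
#print axioms not_b8LeafOfRecord

end Literature.MathematicalPhysics.QuantumFieldTheory.Balaban1983to89.B8Prop3ShellModeVacuity

end
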